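import Literature.Analysis.PDE.ParabolicInterpolation
import HarnessLib

/-!
# Local bounds for normalized `2`-jets on parabolic balls

Topic `Literature/Analysis/PDE` (continuation of `ParabolicInterpolation.lean`).  In the blow-up
arguments one controls only the second spatial derivative `D² w` and the time derivative `∂ₜ w`
of the rescaled functions, normalized by `w(0) = 0`, `D w(0) = 0`.  This file derives from bounds
`‖∂ₜ w‖ ≤ M₁`, `‖D² w‖ ≤ M₂` on the parabolic ball `B(0, 3R)` the bounds and the (parabolic
Lipschitz) moduli of continuity of `w` and `D w` on `B(0, R)` that feed Arzelà–Ascoli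
(`ParabolicJetsLocalCompactness.lean`); each in a `_local` form whose regularity guard is only
assumed on `B(0, 3R)` (resp. `B(0, R)`) and in the everywhere-regular form:

* `norm_spaceDeriv_sub_le_of_t_eq` — `D w` is `M₂`-Lipschitz in space (mean value);
* `norm_spaceDeriv_sub_le_sqrt_of_x_eq` — `D w` is `½`-Hölder in time with constant `M₁ + 2M₂`
  (the parabolic interpolation inequality `norm_spaceDeriv_sub_le_sqrt`);
* `norm_spaceDeriv_sub_le_of_bounds`, `norm_spaceDeriv_le_of_bounds` —
  `‖D w X - D w Y‖ ≤ (M₁ + 3M₂) d(X, Y)` and `‖D w‖ ≤ (M₁ + 3M₂) R` on `B(0, R)`;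
* `norm_sub_le_of_bounds`, `norm_le_of_bounds` — `‖w X - w Y‖ ≤ (3M₁ + 3M₂) R d(X, Y)` and
  `‖w‖ ≤ (3M₁ + 3M₂) R²` on `B(0, R)`.

Everything is PROVED; no definitions, no named facts.

## References

* [White2005] B. White, *A local regularity theorem for mean curvature flow*, Ann. of Math. 161
  (2005), §2.1 (parabolic balls), proof of Thm. 3.1 p. 1498 (uniform local bounds for the
  rescaled sequence before Arzelà–Ascoli).
-/

noncomputable section

open Set Filter Metric Topology Function

namespace Literature.Analysis.PDE

namespace Parabolic

variable {E : Type*} [NormedAddCommGroup E] [NormedSpace ℝ E]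
variable {F : Type*} [NormedAddCommGroup F] [NormedSpace ℝ F]

omit [NormedSpace ℝ E] in
/-- Membership in the parabolic ball `B(0, R)`: `‖x‖ < R` and `|t| < R²`. [cite: White2005, §2.1] -/
theorem mem_ball_zero_iff_of_pos (Z : Parabolic E) {R : ℝ} (hR : 0 < R) :
    Z ∈ ball (0 : Parabolic E) R ↔ ‖Z.x‖ < R ∧ |Z.t| < R ^ 2 := by
  rw [mem_ball, dist_lt_iff _ _ hR]
  simp

omit [NormedSpace ℝ E] in
/-- Points of `B(0, R)` from the coordinates. [cite: White2005, §2.1] -/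
theorem mk_mem_ball_zero {R : ℝ} (hR : 0 < R) {x : E} {t : ℝ} (hx : ‖x‖ < R) (ht : |t| < R ^ 2) :
    (⟨x, t⟩ : Parabolic E) ∈ ball (0 : Parabolic E) R :=
  (mem_ball_zero_iff_of_pos _ hR).2 ⟨hx, ht⟩

variable {w : Parabolic E → F}

/-- **Spatial Lipschitz bound for `D w` from a bound on `D² w`** on a parabolic ball (mean value
inequality on the convex spatial slices); regularity guard only on the ball. [folklore] -/
theorem norm_spaceDeriv_sub_le_of_t_eq_local {R M₂ : ℝ} (hw : IsC21On w (ball (0 : Parabolic E) R))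
    (hR : 0 < R) (hM₂ : ∀ Z ∈ ball (0 : Parabolic E) R, ‖spaceDeriv (spaceDeriv w) Z‖ ≤ M₂)
    {x y : E} {t : ℝ} (hx : ‖x‖ < R) (hy : ‖y‖ < R) (ht : |t| < R ^ 2) :
    ‖spaceDeriv w ⟨x, t⟩ - spaceDeriv w ⟨y, t⟩‖ ≤ M₂ * ‖x - y‖ :=
  (convex_ball (0 : E) R).norm_image_sub_le_of_norm_hasFDerivWithin_le
    (f := fun x' => spaceDeriv w ⟨x', t⟩)
    (fun _ hz => (hw.hasFDerivAt_spaceDeriv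
      (mk_mem_ball_zero hR (mem_ball_zero_iff.1 hz) ht)).hasFDerivWithinAt)
    (fun _ hz => hM₂ _ (mk_mem_ball_zero hR (mem_ball_zero_iff.1 hz) ht))
    (mem_ball_zero_iff.2 hy) (mem_ball_zero_iff.2 hx)

/-- **Spatial Lipschitz bound for `D w` from a bound on `D² w`** on a parabolic ball (mean value
inequality on the convex spatial slices). [folklore] -/
theorem norm_spaceDeriv_sub_le_of_t_eq (hw : IsC21On w univ) {R M₂ : ℝ} (hR : 0 < R)
    (hM₂ : ∀ Z ∈ ball (0 : Parabolic E) R, ‖spaceDeriv (spaceDeriv w) Z‖ ≤ M₂)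
    {x y : E} {t : ℝ} (hx : ‖x‖ < R) (hy : ‖y‖ < R) (ht : |t| < R ^ 2) :
    ‖spaceDeriv w ⟨x, t⟩ - spaceDeriv w ⟨y, t⟩‖ ≤ M₂ * ‖x - y‖ :=
  norm_spaceDeriv_sub_le_of_t_eq_local (hw.mono (subset_univ _)) hR hM₂ hx hy ht

/-- **Temporal `½`-Hölder bound for `D w` from bounds on `∂ₜ w`, `D² w`** on the larger ball
`B(0, 3R)` (parabolic interpolation, `norm_spaceDeriv_sub_le_sqrt`); regularity guard only on
`B(0, 3R)`. [folklore] -/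
theorem norm_spaceDeriv_sub_le_sqrt_of_x_eq_local {R M₁ M₂ : ℝ}
    (hw : IsC21On w (ball (0 : Parabolic E) (3 * R))) (hR : 0 < R)
    (hM₁ : ∀ Z ∈ ball (0 : Parabolic E) (3 * R), ‖timeDeriv w Z‖ ≤ M₁)
    (hM₂ : ∀ Z ∈ ball (0 : Parabolic E) (3 * R), ‖spaceDeriv (spaceDeriv w) Z‖ ≤ M₂)
    {x : E} {s t : ℝ} (hx : ‖x‖ < R) (hs : |s| < R ^ 2) (ht : |t| < R ^ 2) :
    ‖spaceDeriv w ⟨x, s⟩ - spaceDeriv w ⟨x, t⟩‖ ≤ (M₁ + 2 * M₂) * Real.sqrt |s - t| := by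
  rcases eq_or_ne t s with rfl | hts
  · simp
  have h3R : 0 < 3 * R := by positivity
  set ρ : ℝ := Real.sqrt |s - t| with hρ
  have hρR : ρ < 2 * R := by
    have h1 : |s - t| < (2 * R) ^ 2 := by
      have := abs_sub s t; nlinarith
    calc ρ = Real.sqrt |s - t| := rfl
      _ < Real.sqrt ((2 * R) ^ 2) := Real.sqrt_lt_sqrt (abs_nonneg _) h1
      _ = 2 * R := Real.sqrt_sq (by positivity)
  -- the region `B̄(x, ρ) × [t, s]` lies in `B(0, 3R)`
  have hτ : ∀ τ ∈ uIcc t s, |τ| < (3 * R) ^ 2 := fun τ hτ' => by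
    have h9 : R ^ 2 ≤ (3 * R) ^ 2 := by nlinarith
    rcases le_total t s with h | h
    · rw [uIcc_of_le h] at hτ'
      exact lt_of_lt_of_le (abs_lt.2 ⟨by linarith [hτ'.1, (abs_lt.1 ht).1],
        by linarith [hτ'.2, (abs_lt.1 hs).2]⟩) h9
    · rw [uIcc_of_ge h] at hτ'
      exact lt_of_lt_of_le (abs_lt.2 ⟨by linarith [hτ'.1, (abs_lt.1 hs).1],
        by linarith [hτ'.2, (abs_lt.1 ht).2]⟩) h9
  have hyn : ∀ y ∈ closedBall x ρ, ‖y‖ < 3 * R := fun y hy => by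
    have h1 : ‖y - x‖ ≤ ρ := by rwa [mem_closedBall, dist_eq_norm] at hy
    have h2 : ‖y‖ ≤ ‖x‖ + ‖y - x‖ := norm_le_norm_add_norm_sub' y x
    linarith
  have hmem : ∀ y ∈ closedBall x ρ, ∀ τ ∈ uIcc t s,
      (⟨y, τ⟩ : Parabolic E) ∈ ball (0 : Parabolic E) (3 * R) :=
    fun y hy τ hτ' => mk_mem_ball_zero h3R (hyn y hy) (hτ τ hτ')
  have hM₂0 : 0 ≤ M₂ := (norm_nonneg (spaceDeriv (spaceDeriv w) ⟨x, t⟩)).trans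
    (hM₂ _ (hmem x (mem_closedBall_self (Real.sqrt_nonneg _)) t left_mem_uIcc))
  have hτmem : ∀ τ ∈ ({t, s} : Set ℝ), τ ∈ uIcc t s := by
    rintro τ (rfl | rfl)
    · exact left_mem_uIcc
    · exact right_mem_uIcc
  refine norm_spaceDeriv_sub_le_sqrt (Du := spaceDeriv w) (ut := timeDeriv w) hts hM₂0
    (fun τ hτ' y hy => hw.hasFDerivAt_space (hmem y hy τ (hτmem τ hτ'))) (fun τ hτ' y hy => ?_)
    (fun y hy τ hτ' => (hw.hasDerivAt_time (hmem y hy τ hτ')).hasDerivWithinAt)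
    (fun y hy τ hτ' => hM₁ _ (hmem y hy τ hτ'))
  -- the Lipschitz bound at the times `t`, `s`, on the convex closed ball
  exact (convex_closedBall x ρ).norm_image_sub_le_of_norm_hasFDerivWithin_le
    (f := fun y' => spaceDeriv w ⟨y', τ⟩)
    (fun z hz => (hw.hasFDerivAt_spaceDeriv (hmem z hz τ (hτmem τ hτ'))).hasFDerivWithinAt)
    (fun z hz => hM₂ _ (hmem z hz τ (hτmem τ hτ'))) (mem_closedBall_self (Real.sqrt_nonneg _)) hy

/-- **Temporal `½`-Hölder bound for `D w` from bounds on `∂ₜ w`, `D² w`** on the larger ball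
`B(0, 3R)` (parabolic interpolation, `norm_spaceDeriv_sub_le_sqrt`). [folklore] -/
theorem norm_spaceDeriv_sub_le_sqrt_of_x_eq (hw : IsC21On w univ) {R M₁ M₂ : ℝ} (hR : 0 < R)
    (hM₁ : ∀ Z ∈ ball (0 : Parabolic E) (3 * R), ‖timeDeriv w Z‖ ≤ M₁)
    (hM₂ : ∀ Z ∈ ball (0 : Parabolic E) (3 * R), ‖spaceDeriv (spaceDeriv w) Z‖ ≤ M₂)
    {x : E} {s t : ℝ} (hx : ‖x‖ < R) (hs : |s| < R ^ 2) (ht : |t| < R ^ 2) :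
    ‖spaceDeriv w ⟨x, s⟩ - spaceDeriv w ⟨x, t⟩‖ ≤ (M₁ + 2 * M₂) * Real.sqrt |s - t| :=
  norm_spaceDeriv_sub_le_sqrt_of_x_eq_local (hw.mono (subset_univ _)) hR hM₁ hM₂ hx hs ht


/-- **Bound and parabolic Lipschitz modulus for the gradient of a normalized jet**: if `w` satisfies
the guard everywhere with `D w (0) = 0`, `‖∂ₜ w‖ ≤ M₁` and `‖D² w‖ ≤ M₂` on `B(0, 3R)`, then on
`B(0, R)`: `‖D w (X) - D w (Y)‖ ≤ (M₁ + 3 M₂) dist X Y` and `‖D w (X)‖ ≤ (M₁ + 3 M₂) R`.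
Regularity guard only on `B(0, 3R)`. [folklore] -/
theorem norm_spaceDeriv_sub_le_of_bounds_local {R M₁ M₂ : ℝ}
    (hw : IsC21On w (ball (0 : Parabolic E) (3 * R))) (hR : 0 < R)
    (hM₁ : ∀ Z ∈ ball (0 : Parabolic E) (3 * R), ‖timeDeriv w Z‖ ≤ M₁)
    (hM₂ : ∀ Z ∈ ball (0 : Parabolic E) (3 * R), ‖spaceDeriv (spaceDeriv w) Z‖ ≤ M₂)
    {X Y : Parabolic E} (hX : X ∈ ball (0 : Parabolic E) R) (hY : Y ∈ ball (0 : Parabolic E) R) :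
    ‖spaceDeriv w X - spaceDeriv w Y‖ ≤ (M₁ + 3 * M₂) * dist X Y := by
  obtain ⟨hXx, hXt⟩ := (mem_ball_zero_iff_of_pos X hR).1 hX
  obtain ⟨hYx, hYt⟩ := (mem_ball_zero_iff_of_pos Y hR).1 hY
  have hM₂' : ∀ Z ∈ ball (0 : Parabolic E) R, ‖spaceDeriv (spaceDeriv w) Z‖ ≤ M₂ := fun Z hZ =>
    hM₂ Z (ball_subset_ball (by linarith) hZ)
  have hM₁0 : 0 ≤ M₁ := (norm_nonneg _).trans (hM₁ X (ball_subset_ball (by linarith) hX))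
  have hM₂0 : 0 ≤ M₂ := (norm_nonneg _).trans (hM₂' X hX)
  -- through the intermediate point `(Y.x, X.t)`
  have h1 : ‖spaceDeriv w ⟨X.x, X.t⟩ - spaceDeriv w ⟨Y.x, X.t⟩‖ ≤ M₂ * ‖X.x - Y.x‖ :=
    norm_spaceDeriv_sub_le_of_t_eq_local (hw.mono (ball_subset_ball (by linarith))) hR hM₂' hXx
      hYx hXt
  have h2 : ‖spaceDeriv w ⟨Y.x, X.t⟩ - spaceDeriv w ⟨Y.x, Y.t⟩‖ ≤
      (M₁ + 2 * M₂) * Real.sqrt |X.t - Y.t| :=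
    norm_spaceDeriv_sub_le_sqrt_of_x_eq_local hw hR hM₁ hM₂ hYx hXt hYt
  have hdx : ‖X.x - Y.x‖ ≤ dist X Y := by rw [← dist_eq_norm]; exact dist_x_le X Y
  have hdt : Real.sqrt |X.t - Y.t| ≤ dist X Y := by
    have := sqrt_dist_t_le X Y; rwa [Real.dist_eq] at this
  calc ‖spaceDeriv w X - spaceDeriv w Y‖
      ≤ ‖spaceDeriv w ⟨X.x, X.t⟩ - spaceDeriv w ⟨Y.x, X.t⟩‖ +
          ‖spaceDeriv w ⟨Y.x, X.t⟩ - spaceDeriv w ⟨Y.x, Y.t⟩‖ :=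
        norm_sub_le_norm_sub_add_norm_sub _ _ _
    _ ≤ M₂ * dist X Y + (M₁ + 2 * M₂) * dist X Y := by
        refine add_le_add (h1.trans ?_) (h2.trans ?_)
        · exact mul_le_mul_of_nonneg_left hdx hM₂0
        · exact mul_le_mul_of_nonneg_left hdt (by positivity)
    _ = (M₁ + 3 * M₂) * dist X Y := by ring

/-- **Bound and parabolic Lipschitz modulus for the gradient of a normalized jet**
(`norm_spaceDeriv_sub_le_of_bounds_local` for an everywhere-regular `w`). [folklore] -/
theorem norm_spaceDeriv_sub_le_of_bounds (hw : IsC21On w univ) {R M₁ M₂ : ℝ} (hR : 0 < R)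
    (hM₁ : ∀ Z ∈ ball (0 : Parabolic E) (3 * R), ‖timeDeriv w Z‖ ≤ M₁)
    (hM₂ : ∀ Z ∈ ball (0 : Parabolic E) (3 * R), ‖spaceDeriv (spaceDeriv w) Z‖ ≤ M₂)
    {X Y : Parabolic E} (hX : X ∈ ball (0 : Parabolic E) R) (hY : Y ∈ ball (0 : Parabolic E) R) :
    ‖spaceDeriv w X - spaceDeriv w Y‖ ≤ (M₁ + 3 * M₂) * dist X Y :=
  norm_spaceDeriv_sub_le_of_bounds_local (hw.mono (subset_univ _)) hR hM₁ hM₂ hX hY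

/-- The gradient bound of `norm_spaceDeriv_sub_le_of_bounds`: `‖D w (X)‖ ≤ (M₁ + 3 M₂) R` on
`B(0, R)` when `D w (0) = 0`; regularity guard only on `B(0, 3R)`. [folklore] -/
theorem norm_spaceDeriv_le_of_bounds_local {R M₁ M₂ : ℝ}
    (hw : IsC21On w (ball (0 : Parabolic E) (3 * R))) (hw0 : spaceDeriv w 0 = 0) (hR : 0 < R)
    (hM₁ : ∀ Z ∈ ball (0 : Parabolic E) (3 * R), ‖timeDeriv w Z‖ ≤ M₁)
    (hM₂ : ∀ Z ∈ ball (0 : Parabolic E) (3 * R), ‖spaceDeriv (spaceDeriv w) Z‖ ≤ M₂)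
    {X : Parabolic E} (hX : X ∈ ball (0 : Parabolic E) R) :
    ‖spaceDeriv w X‖ ≤ (M₁ + 3 * M₂) * R := by
  have h := norm_spaceDeriv_sub_le_of_bounds_local hw hR hM₁ hM₂ hX (mem_ball_self hR)
  rw [hw0, sub_zero] at h
  have hM : 0 ≤ M₁ + 3 * M₂ := by
    have hM₁0 : 0 ≤ M₁ := (norm_nonneg _).trans (hM₁ X (ball_subset_ball (by linarith) hX))
    have hM₂0 : 0 ≤ M₂ := (norm_nonneg _).trans (hM₂ X (ball_subset_ball (by linarith) hX))
    positivity
  exact h.trans (mul_le_mul_of_nonneg_left (mem_ball.1 hX).le hM)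

/-- The gradient bound of `norm_spaceDeriv_sub_le_of_bounds`: `‖D w (X)‖ ≤ (M₁ + 3 M₂) R` on
`B(0, R)` when `D w (0) = 0`. [folklore] -/
theorem norm_spaceDeriv_le_of_bounds (hw : IsC21On w univ) (hw0 : spaceDeriv w 0 = 0)
    {R M₁ M₂ : ℝ} (hR : 0 < R)
    (hM₁ : ∀ Z ∈ ball (0 : Parabolic E) (3 * R), ‖timeDeriv w Z‖ ≤ M₁)
    (hM₂ : ∀ Z ∈ ball (0 : Parabolic E) (3 * R), ‖spaceDeriv (spaceDeriv w) Z‖ ≤ M₂)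
    {X : Parabolic E} (hX : X ∈ ball (0 : Parabolic E) R) :
    ‖spaceDeriv w X‖ ≤ (M₁ + 3 * M₂) * R :=
  norm_spaceDeriv_le_of_bounds_local (hw.mono (subset_univ _)) hw0 hR hM₁ hM₂ hX

/-- **Bound and parabolic Lipschitz modulus for a normalized jet**: under the hypotheses of
`norm_spaceDeriv_le_of_bounds` and `w(0) = 0`, on `B(0, R)`:
`‖w X - w Y‖ ≤ (M₁ + 3 M₂ + 2 M₁) R · dist X Y` and `‖w X‖ ≤ (3 M₁ + 3 M₂) R²`; regularity
guard only on `B(0, 3R)`. [folklore] -/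
theorem norm_sub_le_of_bounds_local {R M₁ M₂ : ℝ}
    (hw : IsC21On w (ball (0 : Parabolic E) (3 * R))) (hw0 : spaceDeriv w 0 = 0) (hR : 0 < R)
    (hM₁ : ∀ Z ∈ ball (0 : Parabolic E) (3 * R), ‖timeDeriv w Z‖ ≤ M₁)
    (hM₂ : ∀ Z ∈ ball (0 : Parabolic E) (3 * R), ‖spaceDeriv (spaceDeriv w) Z‖ ≤ M₂)
    {X Y : Parabolic E} (hX : X ∈ ball (0 : Parabolic E) R) (hY : Y ∈ ball (0 : Parabolic E) R) :
    ‖w X - w Y‖ ≤ (3 * M₁ + 3 * M₂) * R * dist X Y := by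
  obtain ⟨hXx, hXt⟩ := (mem_ball_zero_iff_of_pos X hR).1 hX
  obtain ⟨hYx, hYt⟩ := (mem_ball_zero_iff_of_pos Y hR).1 hY
  have hM₁0 : 0 ≤ M₁ := (norm_nonneg _).trans (hM₁ X (ball_subset_ball (by linarith) hX))
  have hM₂0 : 0 ≤ M₂ := (norm_nonneg _).trans (hM₂ X (ball_subset_ball (by linarith) hX))
  -- in space at time `X.t`, with `‖D w‖ ≤ (M₁ + 3M₂) R`
  have h1 : ‖w ⟨X.x, X.t⟩ - w ⟨Y.x, X.t⟩‖ ≤ (M₁ + 3 * M₂) * R * ‖X.x - Y.x‖ :=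
    (convex_ball (0 : E) R).norm_image_sub_le_of_norm_hasFDerivWithin_le
      (f := fun x' => w ⟨x', X.t⟩)
      (fun _ hz => (hw.hasFDerivAt_space (ball_subset_ball (by linarith)
        (mk_mem_ball_zero hR (mem_ball_zero_iff.1 hz) hXt))).hasFDerivWithinAt)
      (fun _ hz => norm_spaceDeriv_le_of_bounds_local hw hw0 hR hM₁ hM₂
        (mk_mem_ball_zero hR (mem_ball_zero_iff.1 hz) hXt))
      (mem_ball_zero_iff.2 hYx) (mem_ball_zero_iff.2 hXx)
  -- in time at the point `Y.x`, with `‖∂ₜ w‖ ≤ M₁`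
  have h2 : ‖w ⟨Y.x, X.t⟩ - w ⟨Y.x, Y.t⟩‖ ≤ M₁ * |X.t - Y.t| := by
    have h := (convex_Ioo (-R ^ 2) (R ^ 2)).norm_image_sub_le_of_norm_hasDerivWithin_le
      (f := fun t' => w ⟨Y.x, t'⟩)
      (fun _ hτ => (hw.hasDerivAt_time (ball_subset_ball (by linarith)
        (mk_mem_ball_zero hR hYx (abs_lt.2 ⟨hτ.1, hτ.2⟩)))).hasDerivWithinAt)
      (fun _ hτ => hM₁ _ (ball_subset_ball (by linarith)
        (mk_mem_ball_zero hR hYx (abs_lt.2 ⟨hτ.1, hτ.2⟩))))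
      (abs_lt.1 hYt |> fun h => ⟨h.1, h.2⟩) (abs_lt.1 hXt |> fun h => ⟨h.1, h.2⟩)
    simpa [Real.norm_eq_abs] using h
  have hdx : ‖X.x - Y.x‖ ≤ dist X Y := by rw [← dist_eq_norm]; exact dist_x_le X Y
  have hdt : |X.t - Y.t| ≤ 2 * R * dist X Y := by
    have h1 : Real.sqrt |X.t - Y.t| ≤ dist X Y := by
      have := sqrt_dist_t_le X Y; rwa [Real.dist_eq] at this
    have h2 : Real.sqrt |X.t - Y.t| ≤ 2 * R := by
      have h3 : |X.t - Y.t| ≤ (2 * R) ^ 2 := by have := abs_sub X.t Y.t; nlinarith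
      calc Real.sqrt |X.t - Y.t| ≤ Real.sqrt ((2 * R) ^ 2) := Real.sqrt_le_sqrt h3
        _ = 2 * R := Real.sqrt_sq (by positivity)
    calc |X.t - Y.t| = Real.sqrt |X.t - Y.t| * Real.sqrt |X.t - Y.t| :=
          (Real.mul_self_sqrt (abs_nonneg _)).symm
      _ ≤ 2 * R * dist X Y :=
          mul_le_mul h2 h1 (Real.sqrt_nonneg _) (by positivity)
  calc ‖w X - w Y‖ ≤ ‖w ⟨X.x, X.t⟩ - w ⟨Y.x, X.t⟩‖ + ‖w ⟨Y.x, X.t⟩ - w ⟨Y.x, Y.t⟩‖ :=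
        norm_sub_le_norm_sub_add_norm_sub _ _ _
    _ ≤ (M₁ + 3 * M₂) * R * dist X Y + M₁ * (2 * R * dist X Y) := by
        refine add_le_add (h1.trans ?_) (h2.trans ?_)
        · exact mul_le_mul_of_nonneg_left hdx (by positivity)
        · exact mul_le_mul_of_nonneg_left hdt hM₁0
    _ = (3 * M₁ + 3 * M₂) * R * dist X Y := by ring

/-- **Bound and parabolic Lipschitz modulus for a normalized jet**
(`norm_sub_le_of_bounds_local` for an everywhere-regular `w`). [folklore] -/
theorem norm_sub_le_of_bounds (hw : IsC21On w univ) (hw0 : spaceDeriv w 0 = 0)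
    {R M₁ M₂ : ℝ} (hR : 0 < R)
    (hM₁ : ∀ Z ∈ ball (0 : Parabolic E) (3 * R), ‖timeDeriv w Z‖ ≤ M₁)
    (hM₂ : ∀ Z ∈ ball (0 : Parabolic E) (3 * R), ‖spaceDeriv (spaceDeriv w) Z‖ ≤ M₂)
    {X Y : Parabolic E} (hX : X ∈ ball (0 : Parabolic E) R) (hY : Y ∈ ball (0 : Parabolic E) R) :
    ‖w X - w Y‖ ≤ (3 * M₁ + 3 * M₂) * R * dist X Y :=
  norm_sub_le_of_bounds_local (hw.mono (subset_univ _)) hw0 hR hM₁ hM₂ hX hY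

/-- The bound `‖w X‖ ≤ (3 M₁ + 3 M₂) R²` on `B(0, R)` for a normalized jet (`w(0) = 0`,
`D w(0) = 0`); regularity guard only on `B(0, 3R)`. [folklore] -/
theorem norm_le_of_bounds_local {R M₁ M₂ : ℝ} (hw : IsC21On w (ball (0 : Parabolic E) (3 * R)))
    (hw00 : w 0 = 0) (hw0 : spaceDeriv w 0 = 0) (hR : 0 < R)
    (hM₁ : ∀ Z ∈ ball (0 : Parabolic E) (3 * R), ‖timeDeriv w Z‖ ≤ M₁)
    (hM₂ : ∀ Z ∈ ball (0 : Parabolic E) (3 * R), ‖spaceDeriv (spaceDeriv w) Z‖ ≤ M₂)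
    {X : Parabolic E} (hX : X ∈ ball (0 : Parabolic E) R) :
    ‖w X‖ ≤ (3 * M₁ + 3 * M₂) * R * R := by
  have h := norm_sub_le_of_bounds_local hw hw0 hR hM₁ hM₂ hX (mem_ball_self hR)
  rw [hw00, sub_zero] at h
  have hM₁0 : 0 ≤ M₁ := (norm_nonneg _).trans (hM₁ X (ball_subset_ball (by linarith) hX))
  have hM₂0 : 0 ≤ M₂ := (norm_nonneg _).trans (hM₂ X (ball_subset_ball (by linarith) hX))
  exact h.trans (mul_le_mul_of_nonneg_left (mem_ball.1 hX).le (by positivity))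

/-- The bound `‖w X‖ ≤ (3 M₁ + 3 M₂) R²` on `B(0, R)` for a normalized jet (`w(0) = 0`,
`D w(0) = 0`). [folklore] -/
theorem norm_le_of_bounds (hw : IsC21On w univ) (hw00 : w 0 = 0) (hw0 : spaceDeriv w 0 = 0)
    {R M₁ M₂ : ℝ} (hR : 0 < R)
    (hM₁ : ∀ Z ∈ ball (0 : Parabolic E) (3 * R), ‖timeDeriv w Z‖ ≤ M₁)
    (hM₂ : ∀ Z ∈ ball (0 : Parabolic E) (3 * R), ‖spaceDeriv (spaceDeriv w) Z‖ ≤ M₂)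
    {X : Parabolic E} (hX : X ∈ ball (0 : Parabolic E) R) :
    ‖w X‖ ≤ (3 * M₁ + 3 * M₂) * R * R :=
  norm_le_of_bounds_local (hw.mono (subset_univ _)) hw00 hw0 hR hM₁ hM₂ hX

end Parabolic

end Literature.Analysis.PDE
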